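import Summits.HubbardSuperconductivity.HubbardSuperconductivity.Theses.ColourTheSpin
import Literature.MathematicalPhysics.QuantumLattice.SpinGaugedHubbardTorus
import Literature.MathematicalPhysics.QuantumLattice.PairFieldEvenSideLRO

/-!
# Crux `SgEndpoint` (stmt-HubbardSuperconductivity-16272, route `ColourTheSpin`, rank 2) —
# BIRTH SKELETON `Lines/birth.lean` (BC3): Born–Oppenheimer descent to the flat `Q₈` sector,
# trivial-twist selection, pure-gauge dictionary, ground-eigenspace homogeneity

The crux (by name: `Theses.ColourTheSpin.SgEndpoint`; restated definitionally below as
`∀ (U δ g₀ c' L₁), 0 < U → δ ∈ (0,½) → 0 < g₀ → 0 < c' → CorridorOrderAt U δ g₀ c' L₁ → SectorLROAt U δ`,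
`sgEndpoint_iff : … := Iff.rfl`): POINTWISE in `(U, δ)`, uniform gauged `B₁g` pair order
`c'·L⁴·‖ψ‖² ≤ ⟨ψ, (Δ_d^g)†Δ_d^g ψ⟩` of EVERY ground state `ψ` of the `N_L`-block of the `Q₈`-spin-gauged
torus `H_g(L,U)` for all `g ∈ (0, g₀]` and all even `L ≥ L₁` (`CorridorOrderAt`, the route's inlined
`let`-text verbatim; by `spinGaugedHubbardTorus_eq_inline` / `spinGaugedPairField_eq_inline` its `H`, `P`,
`p` ARE `spinGaugedHubbardTorus L U g`, `spinGaugedPairField L`, `SpinGauged.HasParticleNumber`) implies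
the summit's matrix at `(U, δ)` (`SectorLROAt`: every normalised `(N_L, S^z = 0)`-sector ground-state
sequence of `hubbardTorus 2 L 1 U` has `d_{x²-y²}` pair-field LRO along even sides).

## The g → 0⁺ mechanism, made precise (what the four stubs say)

Write `H_g = A + g² E + g⁻² M` on the `N_L`-block: `A` = gauge-covariant hopping + Hubbard `U`
(block-DIAGONAL in the link configuration `k : Bond L → Q₈`; its diagonal block at `k` is the
FROZEN-LINK fermion Hamiltonian `frozenHamiltonian L U k`, literally the `(·,k)(·,k)` block of
`spinGaugedHubbardTorusWith Q8.rep L U 0 0`), `E = Σ_b E_b ≥ 0` (sum of projectors), `M` = diagonal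
magnetic weight, `M(k) ∈ ℕ`, `M(k) = 0` iff `k` is FLAT (`IsFlat`: every plaquette holonomy trivial).
Two observations fix the limit: (i) two distinct flat configurations never differ on a single bond, so
on the flat sector `V₀` the electric term is the CONSTANT `(7/8)|Bond L|` — it selects nothing; (ii) a
normalised ground state `ψ_g` has `⟨ψ_g, M ψ_g⟩ ≤ g²(e_min + g²|Bond L| + ‖A‖) → 0` and
`⟨ψ_g, A ψ_g⟩ ≤ e_min + O(g²)`, `e_min = min_{k flat} e₀(k)`, `e₀(k) = frozenGroundEnergy L U N_L k` (trial
state: a frozen ground state at a minimising flat `k`). Hence (compactness of the unit sphere, continuity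
of `ψ ↦ ⟨ψ, Π ψ⟩`, `Π = P†P` block-diagonal with blocks `(frozenPairField L k)†(frozenPairField L k)`) every
limit point `ψ₀ = Σ_{k flat} φ_k ⊗ e_k` is a ground state of `A` on `V₀`: each nonzero `φ_k` is an
`N_L`-block ground state of `H_F(k)` at a flat `k` MINIMISING `e₀` among flat configurations, and the
corridor inequality survives in the limit, so SOME such `φ_k` carries frozen pair order `≥ c'L⁴‖φ_k‖²`.
That is STUB S1 (`stub_bornOppenheimerFlatLimit`) — finite-dimensional analysis, PROVABLE NOW (XL).
The limit lands in the flat class(es) of least fermion energy, NOT automatically in the trivial class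
(refuter route-review note on the item: "at fixed L the g→0⁺ limit only yields ∃ flat class ∃ GS with
order"): STUB S2 (`stub_trivialTwistSelection`, the crux's named bet no. 2, stated under the corridor
antecedent at the same `(U,δ)`) says the minimising flat configurations are eventually PURE GAUGE
(`IsPureGauge`: `k(x,i) = h_x h_{x+eᵢ}⁻¹`), i.e. the zero-twist class is the strict floor among the 22
flat `Q₈` holonomy classes. STUB S3 (`stub_pureGaugeDictionary`, provable once part 3 of
`defn-spinGaugedHubbardTorus` — the gauge unitaries `Γ_y(h)` — lands; M–L): at a pure-gauge `k`,
`H_F(k) = G(h) · hubbardTorus 2 L 1 U · G(h)†` (`L ≥ 3`, `spinGaugedHubbardTorusWith_apply_one_one` at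
`gE = gB = 0` + covariance) and `P_k = G(h) (pairField dWaveFormFactor L/√2) G(h)†`
(`spinGaugedPairField_apply_one_one` + INvariance of the transported singlet), and an `N`-block ground
state with pair-order ratio `≥ a` yields, by `S^z`-decomposition and `SU(2)` lowering `(S⁻)^m` inside one
total-spin component (`Δ_d` is a singlet: `[S^±, Δ_d] = 0`), a normalised `(N, S^z=0)`-SECTOR ground
state of `hubbardTorus 2 L 1 U` with `Re⟨ψ, Δ†Δ ψ⟩ ≥ a` (in fact `≥ 2a`; `N` even). S1+S2+S3 give
`SomeGroundStateOrder U δ c' L₂`: for all large even `L` SOME sector ground state is `d`-wave ordered with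
the corridor's constant. STUB S4 (`stub_someToEveryGroundState`, the crux's named bet no. 1 — the
every-ground-state gap — under the corridor antecedent; implied by the crux itself, see the card): some
⇒ every, with a possibly smaller constant `a' > 0`. The composition `SgEndpoint_of` is then the PROVED
Literature bookkeeping `hasLongRangeOrder_even_of_le` + `sum_pairFieldCorr_succ` (finite-volume order
`a'L⁴` of every sector ground state at all large even `L` ⇒ `HasLongRangeOrder` along `k ↦ 2k`).

Sorry count = 4 = stub count (`stub_bornOppenheimerFlatLimit`, `stub_trivialTwistSelection`,
`stub_pureGaugeDictionary`, `stub_someToEveryGroundState`); everything else — vocabulary lemmas,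
`someGroundStateOrder_of_stubs`, `sectorLROAt_of_everyGroundStateOrder`, `SgEndpoint_of`
(`Sig.S1 → Sig.S2 → Sig.S3 → Sig.S4 → Theses.ColourTheSpin.SgEndpoint`) — is sorry-free;
`SgEndpoint_proof : SgEndpoint` discharges the four stubs.

Disproof used: none exists for this crux (`ledger crux ls stmt-HubbardSuperconductivity-16272`: no
workfiles before this one, 2026-08-17; no `Theorems/SgEndpoint/Negative/*`). Negatives index of the
summit (stmt-1180 BreathingSelfDual at `L = 2`; stmt-1314 KLS order openness) is untouched: no stub
asserts openness of order under `U(1)`-covariant perturbations or a self-duality, and every stub lives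
at even `L ≥ 3` where it touches `hubbardTorus`.
-/

noncomputable section

-- `Summit.<Summit>.<Problem>`: for the single-conjunct summit the duplicate component is mandated.
set_option linter.dupNamespace false
set_option linter.style.longLine false

namespace Summit.HubbardSuperconductivity.HubbardSuperconductivity.Cruxes.SgEndpoint.Birth

/-! ## The crux, cut into antecedent and consequent (route text VERBATIM) -/

section Verbatim

-- exactly the `open`s of the route file `Theses/ColourTheSpin.lean`, so that the text below
-- elaborates to the same term
open scoped BigOperators Topology Manifold Classical MeasureTheory ProbabilityTheory Matrix InnerProductSpace ComplexConjugate ContinuousMap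
open Filter Set Function TopologicalSpace MeasureTheory
open Literature.Hubbard

/-- **The corridor antecedent of `SgEndpoint` at `(U, δ, g₀, c', L₁)`** — the route's text verbatim:
for every `g ∈ (0, g₀]` and every even `L ≥ L₁`, every ground state `ψ` of the `N_L`-particle block of
the `Q₈`-spin-gauged torus `H_g(L,U)` (all Gauss sectors) has gauged `B₁g` pair order
`c'·L⁴·‖ψ‖² ≤ ⟨ψ, P†P ψ⟩`. Its `let H`, `let P`, `let p` are `spinGaugedHubbardTorus L U g`,
`spinGaugedPairField L`, `SpinGauged.HasParticleNumber L N_L` (`spinGaugedHubbardTorus_eq_inline`,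
`spinGaugedPairField_eq_inline`, `hasParticleNumber_iff`, all `rfl`). [folklore] -/
def CorridorOrderAt (U δ g₀ c' : ℝ) (L₁ : ℕ) : Prop :=
  open Literature.MathematicalPhysics.QuantumLattice in ∀ g : ℝ, 0 < g → g ≤ g₀ → ∀ (L : ℕ) [NeZero L], L₁ ≤ L → Even L → (let m : Fin 2 × ZMod 4 → Fin 2 × ZMod 4 → Fin 2 × ZMod 4 := fun u v => (u.1 + v.1, if u.1 = 0 then (if v.1 = 0 then u.2 + v.2 else v.2 - u.2) else if v.1 = 0 then u.2 + v.2 else 2 + v.2 - u.2); let iv : Fin 2 × ZMod 4 → Fin 2 × ZMod 4 := fun u => (u.1, if u.1 = 0 then -u.2 else u.2 + 2); let r : Fin 2 × ZMod 4 → Fin 2 → Fin 2 → ℂ := fun u σ τ => if u.1 = 0 then (if σ = τ then (if σ = 0 then Complex.I else -Complex.I) ^ u.2.val else 0) else if σ = τ then 0 else if σ = 0 then -(-Complex.I) ^ u.2.val else Complex.I ^ u.2.val; let hop := ∑ b : GaugedHubbard.Bond L, ∑ σ : Fin 2, ∑ τ : Fin 2, Matrix.kroneckerMap (· * ·) (creation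 (orb b.1 σ) * annihilation (orb (b.1.shift b.2) τ)) (Matrix.diagonal fun k : GaugedHubbard.Bond L → Fin 2 × ZMod 4 => r (k b) σ τ); let H := -(hop + hopᴴ) + ((U : ℝ) : ℂ) • Matrix.kroneckerMap (· * ·) (∑ x : FermionTorus 2 L, numberOp x 0 * numberOp x 1) (1 : Matrix (GaugedHubbard.Bond L → Fin 2 × ZMod 4) (GaugedHubbard.Bond L → Fin 2 × ZMod 4) ℂ) + ((g ^ 2 : ℝ) : ℂ) • Matrix.kroneckerMap (· * ·) (1 : Matrix (Finset (Orb (FermionTorus 2 L))) _ ℂ) (∑ b : GaugedHubbard.Bond L, Matrix.of fun k k' : GaugedHubbard.Bond L → Fin 2 × ZMod 4 => if k' = Function.update k b (k' b) then (if k b = k' b then (1 : ℂ) else 0) - 1 / 8 else 0) + ((1 / g ^ 2 : ℝ) : ℂ) • Matrix.kroneckerMap (· * ·) (1 : Matrix (Finset (Orb (FermionTorus 2 L))) _ ℂ) (Matrix.diagonal fun k : GaugedHubbard.Bond L → Fin 2 × ZMod 4 => ∑ x : FermionTorus 2 L, (1 - (r (m (m (m (k (x, 0)) (k (x.shift 0,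 1))) (iv (k (x.shift 1, 0)))) (iv (k (x, 1)))) 0 0 + r (m (m (m (k (x, 0)) (k (x.shift 0, 1))) (iv (k (x.shift 1, 0)))) (iv (k (x, 1)))) 1 1) / 2)); let P := ∑ b : GaugedHubbard.Bond L, (if b.2 = 0 then (1 : ℂ) else -1) • ∑ σ : Fin 2, ∑ τ : Fin 2, Matrix.kroneckerMap (· * ·) (annihilation (orb b.1 σ) * annihilation (orb (b.1.shift b.2) τ)) (Matrix.diagonal fun k : GaugedHubbard.Bond L → Fin 2 × ZMod 4 => if σ = 0 then r (k b) 1 τ else -r (k b) 0 τ); let p := fun ik : Finset (Orb (FermionTorus 2 L)) × (GaugedHubbard.Bond L → Fin 2 × ZMod 4) => ik.1.card = 2 * ⌊(1 - δ) * (L : ℝ) ^ 2 / 2⌋₊; ∀ ψ : {ik // p ik} → ℂ, (ψ ≠ 0 ∧ ∃ E : ℝ, H.toBlock p p *ᵥ ψ = (E : ℂ) • ψ ∧ ∀ φ : {ik // p ik} → ℂ, E * (star φ ⬝ᵥ φ).re ≤ (star φ ⬝ᵥ H.toBlock p p *ᵥ φ).re) → c' * (L : ℝ) ^ 4 * (star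 ψ ⬝ᵥ ψ).re ≤ (star ψ ⬝ᵥ (Pᴴ * P).toBlock p p *ᵥ ψ).re)

/-- **The consequent of `SgEndpoint` at `(U, δ)`** — the summit's matrix verbatim
(`Literature.Hubbard.DWaveSuperconductivityHubbard` with its two leading existentials stripped): every
normalised `(N_L, S^z = 0)`-sector ground-state sequence of `hubbardTorus 2 L 1 U` has `d_{x²-y²}`
pair-field long-range order along even sides. [folklore] -/
def SectorLROAt (U δ : ℝ) : Prop :=
  open Literature.MathematicalPhysics.QuantumLattice in ∀ (N : ℕ → ℕ) (ψ : ∀ L, Fock (Orb (FermionTorus 2 L))), (∀ L, Even L → N L = 2 * ⌊(1 - δ) * (L : ℝ) ^ 2 / 2⌋₊ ∧ star (ψ L) ⬝ᵥ ψ L = 1 ∧ IsGroundStateInSector (hubbardTorus 2 L 1 U) (N L) 0 (ψ L)) → Literature.Probability.LatticeModels.HasLongRangeOrder (fun k => Literature.Probability.LatticeModels.halfOpenBox 2 (2 * k)) (fun k => torusPullback (pairFieldCorr dWaveFormFactor ψ) (2 * k))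

/-- The crux BY NAME is, definitionally, "antecedent → consequent, pointwise in `(U, δ)`". [folklore] -/
theorem sgEndpoint_iff :
    Summit.HubbardSuperconductivity.HubbardSuperconductivity.Theses.ColourTheSpin.SgEndpoint ↔
      ∀ (U δ g₀ c' : ℝ) (L₁ : ℕ), 0 < U → δ ∈ Set.Ioo (0 : ℝ) (1 / 2) → 0 < g₀ → 0 < c' →
        CorridorOrderAt U δ g₀ c' L₁ → SectorLROAt U δ :=
  Iff.rfl

end Verbatim

open Matrix Finset Filter
open Literature.Probability.LatticeModels Literature.MathematicalPhysics.QuantumLattice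
open scoped ComplexOrder

/-! ## Vocabulary of the line (frozen-link objects; all over landed Literature declarations) -/

/-- **The frozen-link fermion Hamiltonian `H_F(k)`** at the link configuration `k : Bond L → Q₈`:
`-Σ_{b,σ,τ} (ρ(k_b)_{στ} c†_{xσ} c_{x+eᵢ,τ} + h.c.) + U Σ_x n_{x↑} n_{x↓}`, DEFINED as the diagonal
`(·,k)(·,k)` block of the gauge–fermion part `A = spinGaugedHubbardTorusWith Q8.rep L U 0 0` of `H_g`
(no electric, no magnetic term), so that no sign or orientation convention can drift from the route's.
`A` is block-diagonal in `k` (its link factors are `Matrix.diagonal`). [folklore] -/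
def frozenHamiltonian (L : ℕ) [NeZero L] (U : ℝ) (k : GaugedHubbard.Bond L → Q8) :
    Matrix (Finset (Orb (FermionTorus 2 L))) (Finset (Orb (FermionTorus 2 L))) ℂ :=
  Matrix.of fun s s' => spinGaugedHubbardTorusWith Q8.rep L U 0 0 (s, k) (s', k)

/-- **The frozen-link transported pair field `P_k`**: the diagonal `(·,k)(·,k)` block of the route's
gauge-invariant `B₁g` pair field `spinGaugedPairField L` (block-diagonal in `k`). [folklore] -/
def frozenPairField (L : ℕ) [NeZero L] (k : GaugedHubbard.Bond L → Q8) :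
    Matrix (Finset (Orb (FermionTorus 2 L))) (Finset (Orb (FermionTorus 2 L))) ℂ :=
  Matrix.of fun s s' => spinGaugedPairField L (s, k) (s', k)

/-- `k` is a FLAT `Q₈` connection: every plaquette holonomy is trivial (zero magnetic weight).
[folklore] -/
def IsFlat (L : ℕ) [NeZero L] (k : GaugedHubbard.Bond L → Q8) : Prop :=
  ∀ x : FermionTorus 2 L, SpinGauged.holonomy L k x = 1

/-- `k` is PURE GAUGE: the gauge transform of the trivial configuration by a vertex field
`h : sites → Q₈`, `k(x,i) = h_x · h_{x+eᵢ}⁻¹` (the trivial holonomy class among the 22 flat classes).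
[folklore] -/
def IsPureGauge (L : ℕ) [NeZero L] (k : GaugedHubbard.Bond L → Q8) : Prop :=
  ∃ h : FermionTorus 2 L → Q8, ∀ b : GaugedHubbard.Bond L, k b = h b.1 * (h (b.1.shift b.2))⁻¹

/-- The `N`-block ground energy `e₀(k)` of the frozen-link Hamiltonian. [folklore] -/
def frozenGroundEnergy (L : ℕ) [NeZero L] (U : ℝ) (N : ℕ) (k : GaugedHubbard.Bond L → Q8) : ℝ :=
  (frozenHamiltonian L U k).minEnergyOn
    (nParticleSubmodule N : Submodule ℂ (Fock (Orb (FermionTorus 2 L))))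

/-- `k` is flat and minimises the `N`-block frozen ground energy among FLAT configurations (the
classes on which the `g → 0⁺` ground states concentrate). [folklore] -/
def IsFlatMinimiser (L : ℕ) [NeZero L] (U : ℝ) (N : ℕ) (k : GaugedHubbard.Bond L → Q8) : Prop :=
  IsFlat L k ∧ ∀ k' : GaugedHubbard.Bond L → Q8, IsFlat L k' →
    frozenGroundEnergy L U N k ≤ frozenGroundEnergy L U N k'

/-- `φ` is an `N`-block ground state of the frozen-link Hamiltonian at `k`: an `N`-particle vector,
nonzero, eigenvector at the `N`-block ground energy (the analogue of `IsGroundStateInSector` without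
the `S^z` constraint — `H_F(k)` conserves particle number but not `S^z`). [folklore] -/
def IsFrozenGroundState (L : ℕ) [NeZero L] (U : ℝ) (N : ℕ) (k : GaugedHubbard.Bond L → Q8)
    (φ : Fock (Orb (FermionTorus 2 L))) : Prop :=
  φ ∈ (nParticleSubmodule N : Submodule ℂ (Fock (Orb (FermionTorus 2 L)))) ∧ φ ≠ 0 ∧
    frozenHamiltonian L U k *ᵥ φ = ((frozenGroundEnergy L U N k : ℝ) : ℂ) • φ

/-- SOME-ground-state `d`-wave order at `(U, δ)` with constant `a` from side `L₂` on: for every even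
`L ≥ L₂` some normalised `(N_L, S^z = 0)`-sector ground state `ψ` of `hubbardTorus 2 L 1 U` has
`a·L⁴ ≤ Re⟨ψ, Δ†Δ ψ⟩`, `Δ = pairField dWaveFormFactor L`. [folklore] -/
def SomeGroundStateOrder (U δ a : ℝ) (L₂ : ℕ) : Prop :=
  ∀ (L : ℕ) [NeZero L], L₂ ≤ L → Even L →
    ∃ ψ : Fock (Orb (FermionTorus 2 L)), star ψ ⬝ᵥ ψ = 1 ∧
      IsGroundStateInSector (hubbardTorus 2 L 1 U) (2 * ⌊(1 - δ) * (L : ℝ) ^ 2 / 2⌋₊) 0 ψ ∧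
        a * (L : ℝ) ^ 4 ≤ (expect ((pairField dWaveFormFactor L)ᴴ * pairField dWaveFormFactor L) ψ).re

/-- EVERY-ground-state `d`-wave order at `(U, δ)` with constant `a` from side `L₃` on. [folklore] -/
def EveryGroundStateOrder (U δ a : ℝ) (L₃ : ℕ) : Prop :=
  ∀ (L : ℕ) [NeZero L], L₃ ≤ L → Even L →
    ∀ ψ : Fock (Orb (FermionTorus 2 L)), star ψ ⬝ᵥ ψ = 1 →
      IsGroundStateInSector (hubbardTorus 2 L 1 U) (2 * ⌊(1 - δ) * (L : ℝ) ^ 2 / 2⌋₊) 0 ψ →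
        a * (L : ℝ) ^ 4 ≤ (expect ((pairField dWaveFormFactor L)ᴴ * pairField dWaveFormFactor L) ψ).re

/-! ### The vocabulary computes (sorry-free sanity lemmas) -/

/-- The trivial configuration is flat. [folklore] -/
theorem isFlat_one (L : ℕ) [NeZero L] : IsFlat L (1 : GaugedHubbard.Bond L → Q8) :=
  fun x => SpinGauged.holonomy_one L x

/-- The trivial configuration is pure gauge (`h ≡ 1`). [folklore] -/
theorem isPureGauge_one (L : ℕ) [NeZero L] : IsPureGauge L (1 : GaugedHubbard.Bond L → Q8) :=
  ⟨fun _ => 1, fun b => by simp⟩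

/-- **Dictionary at the trivial configuration, Hamiltonian**: for `L ≥ 3` the frozen-link
Hamiltonian at `k ≡ 1` IS the summit's `hubbardTorus 2 L 1 U` (landed
`spinGaugedHubbardTorusWith_apply_one_one` at `gE = gB = 0`). [folklore] -/
theorem frozenHamiltonian_one (L : ℕ) [NeZero L] (hL : 3 ≤ L) (U : ℝ) :
    frozenHamiltonian L U 1 = hubbardTorus 2 L 1 U := by
  ext s s'
  rw [frozenHamiltonian, Matrix.of_apply, spinGaugedHubbardTorusWith_apply_one_one Q8.rep L hL]
  simp

/-- **Dictionary at the trivial configuration, pair field**: `P_1 = (√2)⁻¹ · pairField dWaveFormFactor L`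
(landed `spinGaugedPairField_apply_one_one`). [folklore] -/
theorem frozenPairField_one (L : ℕ) [NeZero L] :
    frozenPairField L 1 = (((Real.sqrt 2)⁻¹ : ℝ) : ℂ) • pairField dWaveFormFactor L := by
  ext s s'
  rw [frozenPairField, Matrix.of_apply, spinGaugedPairField_apply_one_one, Matrix.smul_apply,
    smul_eq_mul]

/-! ## Stub signatures -/

/-- STUB S1 — BORN–OPPENHEIMER DESCENT TO THE FLAT SECTOR (finite-dimensional, PROVABLE NOW; size XL).
Under the corridor antecedent at `(U, δ, g₀, c', L₁)`: for every even `L ≥ L₁` there are a flat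
configuration `k` minimising the `N_L`-block frozen ground energy among flat configurations and an
`N_L`-block ground state `φ` of `H_F(k)` whose frozen transported pair order is `≥ c'·L⁴·‖φ‖²`.
Proof route: `g_n → 0⁺`, normalised ground states `ψ_n` of the `N_L`-block of `H_{g_n}`; energy
sandwich `⟨ψ_n, Mψ_n⟩ ≤ g_n²(e_min + g_n²|Bond L| + ‖A‖)`, `⟨ψ_n, Aψ_n⟩ ≤ e_min + g_n²|Bond L|`
(`E ≥ 0`; trial state at a flat minimiser); compactness of the unit sphere; a limit point is supported
on flat `k`, is a ground state of `A|_{flat}` (so each nonzero component is a frozen ground state at a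
flat minimiser) and keeps `⟨ψ, Πψ⟩ ≥ c'L⁴` by continuity; `Π = P†P` is block-diagonal with blocks
`(P_k)†P_k`, so some component qualifies. Why it might fail: it cannot, mathematically (Kato-type
finite-dimensional singular perturbation at fixed `L`); the Lean cost is the block-diagonal algebra of
`kroneckerMap … (diagonal …)` and the compactness/continuity bookkeeping.
[cite: doi:10.1103/physrevd.11.395 (Kogut–Susskind Hamiltonian, strong/weak coupling limits)]
[cite: doi:10.1103/physrevd.19.3682] -/
def Sig.stub_bornOppenheimerFlatLimit : Prop :=
  ∀ (U δ g₀ c' : ℝ) (L₁ : ℕ), 0 < U → δ ∈ Set.Ioo (0 : ℝ) (1 / 2) → 0 < g₀ → 0 < c' →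
    CorridorOrderAt U δ g₀ c' L₁ →
      ∀ (L : ℕ) [NeZero L], L₁ ≤ L → Even L →
        ∃ k : GaugedHubbard.Bond L → Q8, IsFlatMinimiser L U (2 * ⌊(1 - δ) * (L : ℝ) ^ 2 / 2⌋₊) k ∧
          ∃ φ : Fock (Orb (FermionTorus 2 L)),
            IsFrozenGroundState L U (2 * ⌊(1 - δ) * (L : ℝ) ^ 2 / 2⌋₊) k φ ∧
              c' * (L : ℝ) ^ 4 * (star φ ⬝ᵥ φ).re ≤
                (star φ ⬝ᵥ ((frozenPairField L k)ᴴ * frozenPairField L k) *ᵥ φ).re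

/-- STUB S2 — TRIVIAL-TWIST SELECTION (the crux's named bet no. 2; OPEN, cheaply testable).
Under the corridor antecedent at `(U, δ)`: for all large even `L`, every flat configuration minimising
the `N_L`-block frozen ground energy among flat configurations is PURE GAUGE — the zero-twist class is
the strict floor of the fermion ground energy among the 22 flat `Q₈` holonomy classes (commuting
holonomy pairs mod conjugation). This is what lets the `g → 0⁺` limit of S1 land in the summit's
Hamiltonian; the electric term does NOT do it (it is the constant `(7/8)|Bond L|` on the flat sector).
Why it might fail: the gauge-invariant singlet condensate is blind to every flat `Q₈` twist (holonomy
`-1` = electronic `π`-flux = a full pair flux quantum; `±i,±j,±k` = opposite `±π/2` fluxes on the two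
spin species), so in a `d`-wave phase the 22 classes are split only by nodal-quasiparticle finite-size
terms `O(1/L)` of undetermined, possibly `L`-alternating sign; at weak `U` free-fermion shell effects make
antiperiodic sectors win at many `(δ, L)`. Cheapest falsifier: sign of `e₀(-1 twist) - e₀(trivial)`
along even `L` for the `U = 0` torus at density `1 - δ`, and in `d`-wave BdG mean field.
[cite: doi:10.1103/physrevd.19.3682 (flat/Higgs–confinement sectors)] [cite: doi:10.1103/physrevb.62.7850]
[cite: arXiv:1910.08931] -/
def Sig.stub_trivialTwistSelection : Prop :=
  ∀ (U δ g₀ c' : ℝ) (L₁ : ℕ), 0 < U → δ ∈ Set.Ioo (0 : ℝ) (1 / 2) → 0 < g₀ → 0 < c' →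
    CorridorOrderAt U δ g₀ c' L₁ →
      ∃ L₂ : ℕ, ∀ (L : ℕ) [NeZero L], L₂ ≤ L → Even L →
        ∀ k : GaugedHubbard.Bond L → Q8,
          IsFlatMinimiser L U (2 * ⌊(1 - δ) * (L : ℝ) ^ 2 / 2⌋₊) k → IsPureGauge L k

/-- STUB S3 — PURE-GAUGE DICTIONARY WITH SPIN LOWERING (provable once the gauge unitaries of
`defn-spinGaugedHubbardTorus` part 3 land; size M–L). For `L ≥ 3`, even `N`, a pure-gauge `k` and an
`N`-block frozen ground state `φ` at `k` with frozen pair-order ratio `≥ a`: there is a NORMALISED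
`(N, S^z = 0)`-sector ground state `ψ` of `hubbardTorus 2 L 1 U` (`IsGroundStateInSector`) with
`a ≤ Re⟨ψ, Δ†Δ ψ⟩`, `Δ = pairField dWaveFormFactor L` (indeed `2a`: `P_1 = Δ/√2`). Proof route: gauge
covariance `H_F(1^h) = G(h) H_F(1) G(h)†`, `P_{1^h} = G(h) P_1 G(h)†` with `G(h) = ⊗_y Γ_y(ρ(h_y))`
number-preserving; `frozenHamiltonian_one`, `frozenPairField_one`; the `N`-block ground energy equals the
`(N, 0)`-sector one (`SU(2)`); split `G(h)†φ` into `S^z`- and total-spin components (`Δ†Δ` commutes with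
`S⃗`), pick a component keeping the ratio, lower it to `S^z = 0` with `(S⁻)^m` (injective on `S^z = m`,
ratio preserved inside one spin multiplet), normalise. Why it might fail: only by a convention slip
(orientation of `1^h`, the factor `√2`) — stated with the weaker constant `a` to absorb the latter.
[cite: Scalapino1995, §2] [cite: Lieb1989 (SU(2) structure of Hubbard eigenspaces)]
[cite: doi:10.1103/physrevd.11.395] -/
def Sig.stub_pureGaugeDictionary : Prop :=
  ∀ (L : ℕ) [NeZero L], 3 ≤ L → ∀ (U a : ℝ) (N : ℕ), Even N →
    ∀ k : GaugedHubbard.Bond L → Q8, IsPureGauge L k →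
      ∀ φ : Fock (Orb (FermionTorus 2 L)), IsFrozenGroundState L U N k φ →
        a * (star φ ⬝ᵥ φ).re ≤ (star φ ⬝ᵥ ((frozenPairField L k)ᴴ * frozenPairField L k) *ᵥ φ).re →
          ∃ ψ : Fock (Orb (FermionTorus 2 L)), star ψ ⬝ᵥ ψ = 1 ∧
            IsGroundStateInSector (hubbardTorus 2 L 1 U) N 0 ψ ∧
              a ≤ (expect ((pairField dWaveFormFactor L)ᴴ * pairField dWaveFormFactor L) ψ).re

/-- STUB S4 — GROUND-EIGENSPACE HOMOGENEITY OF THE `d`-WAVE PAIR ORDER, "some ⇒ every" (the crux's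
named bet no. 1, the every-ground-state gap; OPEN; implied by the crux itself). Under the corridor
antecedent at `(U, δ)`: if from some side on SOME normalised `(N_L, S^z = 0)`-sector ground state has
`Re⟨Δ†Δ⟩ ≥ a·L⁴` (`a > 0`), then from some side on EVERY such ground state has `Re⟨Δ†Δ⟩ ≥ a'·L⁴` for
some `a' > 0`. Trivial where the sector ground state is unique up to phase (generic `U`); by Schur where
the ground eigenspace is irreducible under a symmetry group fixing `Δ†Δ`; the content sits at accidental
or coexistence degeneracies along infinitely many even `L`. Why it might fail: a `Δ†Δ`-dark partner in
an exactly degenerate sector ground eigenspace at the chosen `(U,δ)` for infinitely many even `L`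
(first-order coexistence, e.g. with a striped state near `(U,δ) = (8, 1/8)`), never selected by the
`g → 0⁺` limit. [cite: arXiv:1910.08931 (stripe/d-wave near-degeneracy)] [cite: Yang1962, §4]
[cite: doi:10.1103/physrevb.62.7850] -/
def Sig.stub_someToEveryGroundState : Prop :=
  ∀ (U δ g₀ c' : ℝ) (L₁ : ℕ), 0 < U → δ ∈ Set.Ioo (0 : ℝ) (1 / 2) → 0 < g₀ → 0 < c' →
    CorridorOrderAt U δ g₀ c' L₁ →
      ∀ (a : ℝ) (L₂ : ℕ), 0 < a → SomeGroundStateOrder U δ a L₂ →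
        ∃ a' : ℝ, 0 < a' ∧ ∃ L₃ : ℕ, EveryGroundStateOrder U δ a' L₃

/-! ## Registered stubs (the ONLY `sorry`s of this file) -/

/-- Registered stub S1 (Born–Oppenheimer descent to the flat sector). -/
theorem stub_bornOppenheimerFlatLimit : Sig.stub_bornOppenheimerFlatLimit := by
  sorry

/-- Registered stub S2 (trivial-twist selection among flat `Q₈` classes). -/
theorem stub_trivialTwistSelection : Sig.stub_trivialTwistSelection := by
  sorry

/-- Registered stub S3 (pure-gauge dictionary with spin lowering). -/
theorem stub_pureGaugeDictionary : Sig.stub_pureGaugeDictionary := by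
  sorry

/-- Registered stub S4 (ground-eigenspace homogeneity, some ⇒ every). -/
theorem stub_someToEveryGroundState : Sig.stub_someToEveryGroundState := by
  sorry

/-! ## Composition (sorry-free) -/

/-- S1 + S2 + S3: under the corridor antecedent, SOME sector ground state of the summit's torus is
`d`-wave ordered with the corridor's constant `c'`, for every even `L ≥ max L₁ (max L₂ 3)`. [folklore] -/
theorem someGroundStateOrder_of_stubs (h1 : Sig.stub_bornOppenheimerFlatLimit)
    (h2 : Sig.stub_trivialTwistSelection) (h3 : Sig.stub_pureGaugeDictionary)
    {U δ g₀ c' : ℝ} {L₁ : ℕ} (hU : 0 < U) (hδ : δ ∈ Set.Ioo (0 : ℝ) (1 / 2)) (hg : 0 < g₀)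
    (hc : 0 < c') (hC : CorridorOrderAt U δ g₀ c' L₁) :
    ∃ L₂ : ℕ, SomeGroundStateOrder U δ c' L₂ := by
  obtain ⟨L₂, hsel⟩ := h2 U δ g₀ c' L₁ hU hδ hg hc hC
  refine ⟨max L₁ (max L₂ 3), fun L _ hL hE => ?_⟩
  have hL₁ : L₁ ≤ L := le_trans (le_max_left _ _) hL
  have hL₂ : L₂ ≤ L := le_trans ((le_max_left _ _).trans (le_max_right _ _)) hL
  have hL3 : 3 ≤ L := le_trans ((le_max_right _ _).trans (le_max_right _ _)) hL
  obtain ⟨k, hmin, φ, hφ, hord⟩ := h1 U δ g₀ c' L₁ hU hδ hg hc hC L hL₁ hE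
  have hpure : IsPureGauge L k := hsel L hL₂ hE k hmin
  have hN : Even (2 * ⌊(1 - δ) * (L : ℝ) ^ 2 / 2⌋₊) := even_two_mul _
  exact h3 L hL3 U (c' * (L : ℝ) ^ 4) _ hN k hpure φ hφ hord

/-- Finite-volume order `a·L⁴ ≤ Re⟨ψ_L, Δ†Δ ψ_L⟩` of EVERY sector ground state at all large even `L`
gives the summit's conclusion at `(U, δ)` for every admissible sequence — the landed Literature
bookkeeping `hasLongRangeOrder_even_of_le` with the sum rule `sum_pairFieldCorr_succ`
(`Σ_{x,y} G_L(x,y) = Re⟨Δ†Δ⟩`). [folklore] -/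
theorem sectorLROAt_of_everyGroundStateOrder {U δ a : ℝ} {L₃ : ℕ} (ha : 0 < a)
    (h : EveryGroundStateOrder U δ a L₃) : SectorLROAt U δ := by
  intro N ψ hadm
  refine hasLongRangeOrder_even_of_le dWaveFormFactor ψ (fun n hn => (hadm (n + 1) hn).2.1) ha L₃
    (fun n hn hK => ?_)
  rw [sum_pairFieldCorr_succ dWaveFormFactor ψ n]
  obtain ⟨hNn, hnorm, hgs⟩ := hadm (n + 1) hn
  rw [hNn] at hgs
  exact h (n + 1) hK hn (ψ (n + 1)) hnorm hgs

/-- **THE SKELETON THEOREM.** `Sig.stub_bornOppenheimerFlatLimit → Sig.stub_trivialTwistSelection →`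
`Sig.stub_pureGaugeDictionary → Sig.stub_someToEveryGroundState →`
`Summit.HubbardSuperconductivity.HubbardSuperconductivity.Theses.ColourTheSpin.SgEndpoint`, a real proof
(no `sorry`): by `sgEndpoint_iff` the crux is `Corridor → SectorLRO` pointwise; S1–S3 give some-ground-state
order (`someGroundStateOrder_of_stubs`), S4 upgrades it to every-ground-state order, and
`sectorLROAt_of_everyGroundStateOrder` closes. Every stub is consumed. [folklore] -/
theorem SgEndpoint_of :
    Sig.stub_bornOppenheimerFlatLimit → Sig.stub_trivialTwistSelection →
      Sig.stub_pureGaugeDictionary → Sig.stub_someToEveryGroundState →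
        Summit.HubbardSuperconductivity.HubbardSuperconductivity.Theses.ColourTheSpin.SgEndpoint := by
  intro h1 h2 h3 h4
  refine sgEndpoint_iff.2 fun U δ g₀ c' L₁ hU hδ hg hc hC => ?_
  obtain ⟨L₂, hsome⟩ := someGroundStateOrder_of_stubs h1 h2 h3 hU hδ hg hc hC
  obtain ⟨a, ha, L₃, hall⟩ := h4 U δ g₀ c' L₁ hU hδ hg hc hC c' L₂ hc hsome
  exact sectorLROAt_of_everyGroundStateOrder ha hall

/-- The skeleton in its final shape: the crux BY NAME from the four registered stubs (it depends on
`sorryAx` through the stubs only — no `sorry` of its own). [folklore] -/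
theorem SgEndpoint_proof :
    Summit.HubbardSuperconductivity.HubbardSuperconductivity.Theses.ColourTheSpin.SgEndpoint :=
  SgEndpoint_of stub_bornOppenheimerFlatLimit stub_trivialTwistSelection stub_pureGaugeDictionary
    stub_someToEveryGroundState

end Summit.HubbardSuperconductivity.HubbardSuperconductivity.Cruxes.SgEndpoint.Birth

end
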